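import Summits.BirchSwinnertonDyer.BirchSwinnertonDyer.Theorems.KolyvaginDepthDoorDepthTableKuriharaESide4
import Summits.BirchSwinnertonDyer.BirchSwinnertonDyer.Theorems.KolyvaginDepthDoorDepthTableKuriharaExactRow
import Summits.BirchSwinnertonDyer.BirchSwinnertonDyer.Theorems.KolyvaginDepthDoorDepthTableRankTwo997b1Neg23TwistBSDQuotient
import Summits.BirchSwinnertonDyer.BirchSwinnertonDyer.Theorems.KolyvaginDepthDoorDepthTableRows997TwoShaModRank
import Literature.NumberTheory.EllipticCurves.BSDSelmerPConverseSerreProofs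
import HarnessLib

/-!
# Route `KolyvaginDepthDoor`, crux `KolyvaginDepthSupplyKN` (stmt-BirchSwinnertonDyer-22820) —
# DEPTH TABLE v20, ROW `997b1` @ `(7, d_K = -23)` — the ALTERNATIVE HEEGNER FIELD `ℚ(√-23)` of `997`: the twist model
# `T₀ = [0, -1, 1, -2821, 55579]` at `7`, the exact-modulo-rank row, and the SOCKET for the fleet's twist record (conductor `N_{T₀} = 527413`)

Helper file of the lead prover of line `levelone` (kdd-p1 g24; `--supports stmt-BirchSwinnertonDyer-22820
--as helper`); it closes nothing and BSD is NOT proved by it. Same template as `…KuriharaSocket997b1` (♠ cell at `p = 7`).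

WHY A SECOND FIELD FOR `997b1`. The row of record `997b1` @ `(7, -52)` has a socket (g22/g23) but no decisive prime: no
rational point is known on its twist model (searches of g16/g23: none of naive height `≤ 10⁸`). The crux is `∃ p ∃ K`, and at
the Heegner field `K = ℚ(√-23)` of `997` (`(-23/997) = 1`, `C997b1.heegner_neg23`, g16; `7 ∤ 23`) the v12 table ALREADY holds a
kernel twist point (`C997b1.one_le_rank_twist_neg23`), and g19 landed the globally minimal twist model `T₀` with
`minTwist23_isElliptic/_isGloballyMinimal/_smul_eq/_intModel` (`…RankTwo997b1Neg23TwistBSDQuotient`). This file opens the row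
`(7, -23)` in Kurihara currency so that the companion `…KuriharaDecisive997b1Neg23` can name its decisive prime:

* `minTwist23_card_7`, `minTwist23_nonAnomalous_7`, `minTwist23_kodairaNeron_7` — `#T̃₀(𝔽_7) = 6`, `a_7(T₀) = 2 ≢ 1 (mod 7)`;
  `7 ∤ ord_v(Δ_{T₀})` at multiplicative `v` (`Δ(T₀) = 23⁶·997`) (kernel).
* `exactRowZhang_7_neg23` — the ♠ row at `(7, -23)` READ EXACTLY MODULO RANK: bit ⟺ «`rank E = 2` ∧ `Ш(E)[7] = 0` ∧
  `#Sel_7(E^{(-23)}) ≤ 7`» (g14's generic `kolyvaginClass_prime_ne_zero_iff_rankTwo_shaTrivial_twistSelmer_of_lemma84`, (γ) +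
  W. Zhang L8.4 (1) by name; `2 ≤ rank` by `KernelCertsR01.C997b1.two_le_rank`; no 2-descent certificate for `997b1` in the tree, so the
  rank conjunct stays — as in g16's `exactRowZhang_5_neg23`).
* `cruxBody_of_twistKuriharaClaim_7_neg23` — **THE SOCKET**: for every `K` with `d_K = -23`, IF some cyclic Kolyvagin level `m` of
  `(T₀, 7)` with `ν(m) ≤ 2` carries a unit mod-`7` Kurihara number (the CLAIM of a future tree record `cert_<T₀>` at `(7, m)`),
  THEN the clause of `KolyvaginDepthSupplyKN` holds at `W = 997b1` verbatim (v17's `cruxBody_of_kuriharaClaims_spade`; Kim Thm. 1.11,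
  modularity, Mazur Cor. 4.1, W. Zhang L8.4 (1)/9.1 BY NAME; E-side record `cert_997b1` @ `(7, 29·113)`, claim `hδE`).
  Cyclic Kolyvagin primes of `(T₀, 7)`: `29, 463, 953, 1051, 2297, 2311, …` (CLOSING-DATA-v20).

CONDITIONAL on the named facts displayed and on the record claims; per curve; nothing class-wide; BSD is NOT proved by any of this.

References: [Kim2022StructureSelmer] Thm. 1.11, §1.2.2; [WZhang2014] Lemma 8.4 (1), Thm. 9.1; [GrossLMS1991] Prop. 3.7 (2);
[Mazur1978] Cor. 4.1; [Serre1972] IV.3.4; [CremonaAlgorithms1997] Table 1 (997b1); [SilvermanAEC2009] VII.3.1, VII.5.1, VIII.8, X.4.2, X.5 Cor. 5.4.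
-/

set_option linter.dupNamespace false

noncomputable section

open scoped Classical NumberField

namespace Summit.BirchSwinnertonDyer.BirchSwinnertonDyer.Theorems.KolyvaginDepthDoor

open Literature.NumberTheory.EllipticCurves Literature.NumberTheory.EllipticCurves.ModularForms
  WeierstrassCurve NumberField IsDedekindDomain
open Summit.BirchSwinnertonDyer.BirchSwinnertonDyer.Theorems
open Summit.BirchSwinnertonDyer.BirchSwinnertonDyer.Rank2Observatory
open Summit.BirchSwinnertonDyer.BirchSwinnertonDyer.Rank1Residual (IntModel.frobeniusTrace_eq)
open Summit.BirchSwinnertonDyer.Rank1Residual.Supersingular (natCard_point_eq_of_countPoints countPoints_eq_of_fast)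
open Summit.BirchSwinnertonDyer.Rank1Residual.Additive

namespace C997b1

/-! ## §0 The twist model `T₀ = [0, -1, 1, -2821, 55579]` at `7` (kernel) -/

/-- `#T̃₀(𝔽_7) = 6` for the twist model `T₀ = [0, -1, 1, -2821, 55579]` (`a_7(T₀) = 2`; `7` inert in `ℚ(√-23)`, so `a_7(T₀) = -a_7(E)`),
kernel-decided (`countPointsFast`). [cite: SilvermanAEC2009, V.2] -/
theorem minTwist23_card_7 :
    Nat.card (((⟨0, -1, 1, -2821, 55579⟩ : WeierstrassCurve ℤ).map (Int.castRingHom (ZMod 7))).toAffine.Point) = 6 :=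
  haveI : Fact (Nat.Prime 7) := ⟨by norm_num⟩
  natCard_point_eq_of_countPoints 0 (-1) 1 (-2821) 55579 7 (by norm_num) (by decide +kernel) (n := 6)
    (countPoints_eq_of_fast (by decide +kernel))

/-- **`7` is non-anomalous for the twist model `T₀ = [0, -1, 1, -2821, 55579]`**: `a_7(T₀) = 2`, `7 ∤ a_7(T₀) − 1`
(Sakamoto's hypothesis (c) / Kim's (iii) for `T₀`). [cite: SilvermanAEC2009, VII.3 Prop. 3.1] -/
theorem minTwist23_nonAnomalous_7 :
    haveI := minTwist23_isGloballyMinimal; haveI := Fact.mk (by norm_num : Nat.Prime 7);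
    ¬ ((7 : ℕ) : ℤ) ∣ ((⟨0, -1, 1, -2821, 55579⟩ : WeierstrassCurve ℤ).map (Int.castRingHom ℚ)).frobeniusTrace 7 - 1 := by
  haveI := minTwist23_isElliptic
  haveI := minTwist23_isGloballyMinimal
  haveI := Fact.mk (by norm_num : Nat.Prime 7)
  rw [IntModel.frobeniusTrace_eq minTwist23_intModel minTwist23_card_7]
  decide

/-- **Kodaira–Néron for `T₀ = [0, -1, 1, -2821, 55579]` at `7`**: `7 ∤ ord_v(Δ_{T₀})` at every multiplicative place
(`Δ(T₀) = 147591781333 = 23⁶·997 < 40^7`; exponents `6, 1`, none divisible by `7`; table lemma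
`not_dvd_ordMinimalDiscriminant_of_intModel_table`, as `minTwist23_kodairaNeron_5`). [cite: SilvermanAEC2009, VII.5.1, VIII.8] -/
theorem minTwist23_kodairaNeron_7 :
    haveI := minTwist23_isElliptic; haveI := minTwist23_isGloballyMinimal;
    ∀ v : HeightOneSpectrum (𝓞 ℚ),
      ((⟨0, -1, 1, -2821, 55579⟩ : WeierstrassCurve ℤ).map (Int.castRingHom ℚ)).HasMultiplicativeReductionAt v →
      ¬ 7 ∣ ((⟨0, -1, 1, -2821, 55579⟩ : WeierstrassCurve ℤ).map (Int.castRingHom ℚ)).ordMinimalDiscriminant v := by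
  haveI := minTwist23_isElliptic
  haveI := minTwist23_isGloballyMinimal
  exact not_dvd_ordMinimalDiscriminant_of_intModel_table minTwist23_intModel (p := 7) (Δ₀ := 147591781333)
    (by decide +kernel) (B := 40) (by decide +kernel)
    (by
      intro q hq hqP hqd
      have hn : ((147591781333 : ℤ).natAbs) = 23 ^ 6 * (997 ^ 1) := by norm_num
      rw [hn] at hqd ⊢
      rcases (Nat.Prime.dvd_mul hqP).mp hqd with h | h0
      · obtain rfl := (Nat.prime_dvd_prime_iff_eq hqP (by norm_num)).mp (hqP.dvd_of_dvd_pow h)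
        exact ⟨6, by simp, by decide +kernel, by decide +kernel, by norm_num⟩
      · obtain rfl := (Nat.prime_dvd_prime_iff_eq hqP (by norm_num)).mp (hqP.dvd_of_dvd_pow h0)
        exact absurd (Finset.mem_range.mp hq) (by norm_num))

/-! ## §1 The ♠ row of `997b1` at `(7, -23)`, read exactly modulo rank -/

/-- **DEPTH-TABLE ROW `997b1`, `(p, d_K) = (7, −23)`, READ EXACTLY MODULO RANK on the ♠ cell** (`7` inert in `K`). For
`E = 997b1` (two independent points by `KernelCertsR01.C997b1.two_le_rank`) and ANY imaginary quadratic `K` with `d_K = −23`: «some frame,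
some Kolyvagin prime `ℓ`, some datum of conductor `ℓ` with `c_1(ℓ) ≠ 0`» `↔` «`rank E(ℚ) = 2` ∧ `Ш(E/ℚ)[7] = 0` ∧
`#Sel_7(E^{(−23)}/ℚ) ≤ 7`». Side conditions all kernel theorems (`7` good ordinary, `ρ_{E,7^n}` onto by Serre, non-CM, ♠ (1) +
semistable from `Δ = ±997`, Kodaira–Néron at `7`, Heegner for `N_E = 997`). CONDITIONAL on (γ) and W. Zhang's Lemma 8.4 (1) /
Thm. 9.1 by name; per curve; BSD is not proved by it. [cite: WZhang2014, Lemma 8.4 (1) (p. 236), Thm. 9.1 (p. 240)]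
[cite: GrossLMS1991, Prop. 3.7 (2)] [cite: CremonaAlgorithms1997, Table 1 (997b1)] -/
theorem exactRowZhang_7_neg23
    (h372 : GrossLMS1991.prop37_2_frobeniusCongruence)
    (h84 : Literature.NumberTheory.EllipticCurves.WZhang2014_lemma84_exists_minimal_kolyvaginClass_one_selmerCard)
    (K : Type) [Field K] [NumberField K] (hK : IsImaginaryQuadratic K)
    (hD : NumberField.discr K = -23) :
    haveI := isElliptic_c997b1;
    haveI := isGloballyMinimal_c997b1;
    haveI : NeZero (((⟨0, -1, 1, -5, -3⟩ : WeierstrassCurve ℤ).map (Int.castRingHom ℚ)).conductorNorm ℤ) := neZero_conductorNorm_of_isElliptic _;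
    haveI := Fact.mk (by norm_num : Nat.Prime 7);
    (∃ (Dt : ModularParametrizationData ((⟨0, -1, 1, -5, -3⟩ : WeierstrassCurve ℤ).map (Int.castRingHom ℚ)) (((⟨0, -1, 1, -5, -3⟩ : WeierstrassCurve ℤ).map (Int.castRingHom ℚ)).conductorNorm ℤ)) (β : ℤ)
      (ι : K →+* ℂ) (ℓ : ℕ) (d : KolyvaginHeegnerData Dt β ι ℓ),
      ℓ.Prime ∧ Zhang2014.IsKolyvaginPrime (((⟨0, -1, 1, -5, -3⟩ : WeierstrassCurve ℤ).map (Int.castRingHom ℚ)).conductorNorm ℤ) ((⟨0, -1, 1, -5, -3⟩ : WeierstrassCurve ℤ).map (Int.castRingHom ℚ)) K 7 ℓ ∧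
        d.kolyvaginClass (p := 7) (by norm_num) 1 ≠ 0) ↔
    (((⟨0, -1, 1, -5, -3⟩ : WeierstrassCurve ℤ).map (Int.castRingHom ℚ)).mordellWeilRank = 2 ∧
      (((⟨0, -1, 1, -5, -3⟩ : WeierstrassCurve ℤ).map (Int.castRingHom ℚ)).sha ⊓ AddSubgroup.torsionBy ((⟨0, -1, 1, -5, -3⟩ : WeierstrassCurve ℤ).map (Int.castRingHom ℚ)).galH1 ((7 : ℕ) : ℤ) : AddSubgroup _) = ⊥ ∧
      Nat.card ((((⟨0, -1, 1, -5, -3⟩ : WeierstrassCurve ℤ).map (Int.castRingHom ℚ)).quadraticTwist (NumberField.discr K : ℚ)).selmerGroup (7 : ℕ)) ≤ 7) := by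
  haveI := isElliptic_c997b1
  haveI := isGloballyMinimal_c997b1
  haveI : NeZero (((⟨0, -1, 1, -5, -3⟩ : WeierstrassCurve ℤ).map (Int.castRingHom ℚ)).conductorNorm ℤ) := neZero_conductorNorm_of_isElliptic _
  haveI := Fact.mk (by norm_num : Nat.Prime 7)
  have hgo := goodOrdinary_7
  have hsp := spadeOne_of_five_le 7 (by norm_num)
  have hH := satisfiesHeegnerHypothesis_conductorNorm_of_intModel intModel K hK.1 hD heegner_neg23
  have hKN := kodairaNeron_of_five_le 7 (by norm_num)
  have hS2 : ¬ Squarefree (((⟨0, -1, 1, -5, -3⟩ : WeierstrassCurve ℤ).map (Int.castRingHom ℚ)).conductorNorm ℤ) →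
      (∃ (ℓ : ℕ) (_ : Fact ℓ.Prime), ((⟨0, -1, 1, -5, -3⟩ : WeierstrassCurve ℤ).map (Int.castRingHom ℚ)).HasMultiplicativeReductionAtPrime ℓ ∧
          ¬ 7 ∣ padicValInt ℓ ((⟨0, -1, 1, -5, -3⟩ : WeierstrassCurve ℤ).map (Int.castRingHom ℚ)).minimalDiscriminantInt) ∧
        ∃ (ℓ₁ ℓ₂ : ℕ) (_ : Fact ℓ₁.Prime) (_ : Fact ℓ₂.Prime), ℓ₁ ≠ ℓ₂ ∧
          ((⟨0, -1, 1, -5, -3⟩ : WeierstrassCurve ℤ).map (Int.castRingHom ℚ)).HasMultiplicativeReductionAtPrime ℓ₁ ∧ ((⟨0, -1, 1, -5, -3⟩ : WeierstrassCurve ℤ).map (Int.castRingHom ℚ)).HasMultiplicativeReductionAtPrime ℓ₂ :=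
    fun hns ↦ absurd (((⟨0, -1, 1, -5, -3⟩ : WeierstrassCurve ℤ).map (Int.castRingHom ℚ)).isSemistable_iff_squarefree_conductorNorm.mp hsp.2) hns
  have hD3 : NumberField.discr K ≠ -3 := by rw [hD]; norm_num
  have hD4 : NumberField.discr K ≠ -4 := by rw [hD]; norm_num
  have hpD : ¬ (((7 : ℕ) : ℤ) ∣ NumberField.discr K) := by rw [hD]; norm_num
  have hsur : ((⟨0, -1, 1, -5, -3⟩ : WeierstrassCurve ℤ).map (Int.castRingHom ℚ)).HasSurjectiveModNGaloisRep ((7 : ℕ) : ℤ) := by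
    simpa using hasSurjectiveModNGaloisRep_7
  have htower : ∀ k : ℕ, ((⟨0, -1, 1, -5, -3⟩ : WeierstrassCurve ℤ).map (Int.castRingHom ℚ)).HasSurjectiveModNGaloisRep ((7 : ℕ) ^ k : ℕ) :=
    serre_hasSurjectiveModNGaloisRep_pow_holds _ 7 (by norm_num) hsur
  exact kolyvaginClass_prime_ne_zero_iff_rankTwo_shaTrivial_twistSelmer_of_lemma84 h372 h84 _ not_hasCM
    KernelCertsR01.C997b1.two_le_rank 7 (by norm_num) hgo.1 hgo.2 htower hKN hsp.1 hS2 K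
    hK hD3 hD4 hpD hH

/-! ## §2 The socket at `(7, -23)` -/

/-- **THE SOCKET for row `997b1` @ `(7, −23)`: the clause of `KolyvaginDepthSupplyKN` at `W = 997b1` from the EXISTING
E-side record claim and ONE FUTURE twist record claim.** For every imaginary quadratic `K` with `d_K = −23`: granted
Kim Thm. 1.11 (`hKim`), modularity (`hnf`), Mazur Cor. 4.1 (`hMaz`), W. Zhang L8.4 (1)/9.1 (`h84`) BY NAME, the claim
`hδE` of the tree record `cert_997b1` @ `(7, 3277 = 29·113)`, and — THE DATUM OWED — a cyclic Kolyvagin level `m` of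
`(T₀, 7)` (`hm`) of depth `ν(m) ≤ 2` (`hμ`) whose claim `hδT` holds, the crux's clause holds at `997b1` VERBATIM (witness
field `ℚ(√-23)`). CONDITIONAL on the four named facts and the two claims; per curve; BSD is not proved by it.
[cite: Kim2022StructureSelmer, Thm. 1.11 (PDF p. 8)] [cite: WZhang2014, Lemma 8.4 (1) (p. 236), Thm. 9.1 (p. 240)]
[cite: Mazur1978, Cor. 4.1] [cite: CremonaAlgorithms1997, Table 1 (997b1)] -/
theorem cruxBody_of_twistKuriharaClaim_7_neg23
    (hKim : Kim2022_card_selmerGroup_le_pow_of_kuriharaNumber_ne_zero)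
    (hnf : exists_isNewformOf) (hMaz : mazur_not_dvd_maninConstant_of_odd)
    (h84 : Literature.NumberTheory.EllipticCurves.WZhang2014_lemma84_exists_minimal_kolyvaginClass_one_selmerCard)
    (K : Type) [Field K] [NumberField K] (hK : IsImaginaryQuadratic K) (hD : NumberField.discr K = -23)
    (hδE : haveI := isElliptic_c997b1; haveI := isGloballyMinimal_c997b1;
      haveI : NeZero (((⟨0, -1, 1, -5, -3⟩ : WeierstrassCurve ℤ).map (Int.castRingHom ℚ)).conductorNorm ℤ) := neZero_conductorNorm_of_isElliptic _;
      haveI := Fact.mk (by norm_num : Nat.Prime 7);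
      ∀ (D : ModularParametrizationData ((⟨0, -1, 1, -5, -3⟩ : WeierstrassCurve ℤ).map (Int.castRingHom ℚ)) (((⟨0, -1, 1, -5, -3⟩ : WeierstrassCurve ℤ).map (Int.castRingHom ℚ)).conductorNorm ℤ)), ¬ ((7 : ℕ) : ℤ) ∣ D.maninConstant →
        (∃ u : ℚ, ‖(u : ℚ_[7])‖ = 1 ∧ ((⟨0, -1, 1, -5, -3⟩ : WeierstrassCurve ℤ).map (Int.castRingHom ℚ)).realPeriodRat = u * plusPeriod D.f) →
        ∃ ψ : (ℓ : ℕ) → (ZMod ℓ)ˣ →* Multiplicative (ZMod 7),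
          (∀ ℓ ∈ (3277 : ℕ).primeFactors, Function.Surjective (ψ ℓ)) ∧ kuriharaNumber D.f 7 3277 ψ ≠ 0)
    (m : ℕ) [NeZero m]
    (hm : haveI := minTwist23_isGloballyMinimal;
      IsCyclicKolyvaginLevel ((⟨0, -1, 1, -2821, 55579⟩ : WeierstrassCurve ℤ).map (Int.castRingHom ℚ)) 7 m)
    (hμ : m.primeFactors.card ≤ 2)
    (hδT : haveI := minTwist23_isElliptic; haveI := minTwist23_isGloballyMinimal;
      haveI : NeZero (((⟨0, -1, 1, -2821, 55579⟩ : WeierstrassCurve ℤ).map (Int.castRingHom ℚ)).conductorNorm ℤ) :=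
        neZero_conductorNorm_of_isElliptic _;
      haveI := Fact.mk (by norm_num : Nat.Prime 7);
      ∀ (D : ModularParametrizationData ((⟨0, -1, 1, -2821, 55579⟩ : WeierstrassCurve ℤ).map (Int.castRingHom ℚ))
          (((⟨0, -1, 1, -2821, 55579⟩ : WeierstrassCurve ℤ).map (Int.castRingHom ℚ)).conductorNorm ℤ)),
        ¬ ((7 : ℕ) : ℤ) ∣ D.maninConstant →
        (∃ u : ℚ, ‖(u : ℚ_[7])‖ = 1 ∧
          ((⟨0, -1, 1, -2821, 55579⟩ : WeierstrassCurve ℤ).map (Int.castRingHom ℚ)).realPeriodRat = u * plusPeriod D.f) →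
        ∃ ψ : (ℓ : ℕ) → (ZMod ℓ)ˣ →* Multiplicative (ZMod 7),
          (∀ ℓ ∈ m.primeFactors, Function.Surjective (ψ ℓ)) ∧ kuriharaNumber D.f 7 m ψ ≠ 0) :
    haveI := isElliptic_c997b1; haveI := isGloballyMinimal_c997b1;
    ∃ (p : ℕ) (hp : Fact p.Prime), 5 ≤ p ∧ ((⟨0, -1, 1, -5, -3⟩ : WeierstrassCurve ℤ).map (Int.castRingHom ℚ)).HasGoodReductionAtPrime p ∧
      ¬ (p : ℤ) ∣ ((⟨0, -1, 1, -5, -3⟩ : WeierstrassCurve ℤ).map (Int.castRingHom ℚ)).frobeniusTrace p ∧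
      (∀ n : ℕ, ((⟨0, -1, 1, -5, -3⟩ : WeierstrassCurve ℤ).map (Int.castRingHom ℚ)).HasSurjectiveModNGaloisRep (p ^ n : ℕ)) ∧
      (∀ v : HeightOneSpectrum (𝓞 ℚ), ((⟨0, -1, 1, -5, -3⟩ : WeierstrassCurve ℤ).map (Int.castRingHom ℚ)).HasMultiplicativeReductionAt v →
        ¬ p ∣ ((⟨0, -1, 1, -5, -3⟩ : WeierstrassCurve ℤ).map (Int.castRingHom ℚ)).ordMinimalDiscriminant v) ∧
      ∃ (K : Type) (_ : Field K) (_ : NumberField K), IsImaginaryQuadratic K ∧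
        NumberField.discr K ≠ -3 ∧ NumberField.discr K ≠ -4 ∧
        ∃ (_ : NeZero (((⟨0, -1, 1, -5, -3⟩ : WeierstrassCurve ℤ).map (Int.castRingHom ℚ)).conductorNorm ℤ)),
          SatisfiesHeegnerHypothesis (((⟨0, -1, 1, -5, -3⟩ : WeierstrassCurve ℤ).map (Int.castRingHom ℚ)).conductorNorm ℤ) K ∧
        ∃ (Dt : ModularParametrizationData ((⟨0, -1, 1, -5, -3⟩ : WeierstrassCurve ℤ).map (Int.castRingHom ℚ)) (((⟨0, -1, 1, -5, -3⟩ : WeierstrassCurve ℤ).map (Int.castRingHom ℚ)).conductorNorm ℤ))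
          (β : ℤ) (ι : K →+* ℂ) (n₁ : ℕ) (d : KolyvaginHeegnerData Dt β ι n₁), Squarefree n₁ ∧
          (∀ q ∈ n₁.primeFactors, Zhang2014.IsKolyvaginPrime (((⟨0, -1, 1, -5, -3⟩ : WeierstrassCurve ℤ).map (Int.castRingHom ℚ)).conductorNorm ℤ)
            ((⟨0, -1, 1, -5, -3⟩ : WeierstrassCurve ℤ).map (Int.castRingHom ℚ)) K p q) ∧
          d.kolyvaginClass hp.out 1 ≠ 0 ∧
          (n₁.primeFactors.card + 1 ≤ ((⟨0, -1, 1, -5, -3⟩ : WeierstrassCurve ℤ).map (Int.castRingHom ℚ)).mordellWeilRank ∨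
            (n₁.primeFactors.card ≤ ((⟨0, -1, 1, -5, -3⟩ : WeierstrassCurve ℤ).map (Int.castRingHom ℚ)).mordellWeilRank ∧
              n₁.primeFactors.card + 1 ≤ (((⟨0, -1, 1, -5, -3⟩ : WeierstrassCurve ℤ).map (Int.castRingHom ℚ)).quadraticTwist
                (NumberField.discr K : ℚ)).mordellWeilRank)) := by
  haveI := isElliptic_c997b1
  haveI := isGloballyMinimal_c997b1
  haveI iNZ : NeZero (((⟨0, -1, 1, -5, -3⟩ : WeierstrassCurve ℤ).map (Int.castRingHom ℚ)).conductorNorm ℤ) :=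
    neZero_conductorNorm_of_isElliptic _
  haveI := minTwist23_isElliptic
  haveI := minTwist23_isGloballyMinimal
  haveI iNZT : NeZero (((⟨0, -1, 1, -2821, 55579⟩ : WeierstrassCurve ℤ).map (Int.castRingHom ℚ)).conductorNorm ℤ) :=
    neZero_conductorNorm_of_isElliptic _
  haveI iP := Fact.mk (by norm_num : Nat.Prime 7)
  haveI : NeZero (3277 : ℕ) := ⟨by norm_num⟩
  have hsp := spadeOne_of_five_le 7 (by norm_num)
  have hS2 : ¬ Squarefree (((⟨0, -1, 1, -5, -3⟩ : WeierstrassCurve ℤ).map (Int.castRingHom ℚ)).conductorNorm ℤ) →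
      (∃ (ℓ : ℕ) (_ : Fact ℓ.Prime), ((⟨0, -1, 1, -5, -3⟩ : WeierstrassCurve ℤ).map (Int.castRingHom ℚ)).HasMultiplicativeReductionAtPrime ℓ ∧
          ¬ 7 ∣ padicValInt ℓ ((⟨0, -1, 1, -5, -3⟩ : WeierstrassCurve ℤ).map (Int.castRingHom ℚ)).minimalDiscriminantInt) ∧
        ∃ (ℓ₁ ℓ₂ : ℕ) (_ : Fact ℓ₁.Prime) (_ : Fact ℓ₂.Prime), ℓ₁ ≠ ℓ₂ ∧
          ((⟨0, -1, 1, -5, -3⟩ : WeierstrassCurve ℤ).map (Int.castRingHom ℚ)).HasMultiplicativeReductionAtPrime ℓ₁ ∧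
          ((⟨0, -1, 1, -5, -3⟩ : WeierstrassCurve ℤ).map (Int.castRingHom ℚ)).HasMultiplicativeReductionAtPrime ℓ₂ :=
    fun hns ↦ absurd ((((⟨0, -1, 1, -5, -3⟩ : WeierstrassCurve ℤ).map (Int.castRingHom ℚ))).isSemistable_iff_squarefree_conductorNorm.mp hsp.2) hns
  have hH := satisfiesHeegnerHypothesis_conductorNorm_of_intModel intModel K hK.1 hD heegner_neg23
  have hD3 : NumberField.discr K ≠ -3 := by rw [hD]; norm_num
  have hD4 : NumberField.discr K ≠ -4 := by rw [hD]; norm_num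
  have hpD : ¬ (((7 : ℕ) : ℤ) ∣ NumberField.discr K) := by rw [hD]; decide
  have hsur : ((⟨0, -1, 1, -5, -3⟩ : WeierstrassCurve ℤ).map (Int.castRingHom ℚ)).HasSurjectiveModNGaloisRep ((7 : ℕ) : ℤ) := by
    simpa using hasSurjectiveModNGaloisRep_7
  have htower : ∀ k : ℕ, ((⟨0, -1, 1, -5, -3⟩ : WeierstrassCurve ℤ).map (Int.castRingHom ℚ)).HasSurjectiveModNGaloisRep ((7 : ℕ) ^ k : ℕ) :=
    serre_hasSurjectiveModNGaloisRep_pow_holds _ 7 (by norm_num) hsur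
  have hC : (⟨1, (8 : ℚ), (0 : ℚ), -((1 : ℚ) / 2)⟩ : WeierstrassCurve.VariableChange ℚ) •
      ((⟨0, -1, 1, -2821, 55579⟩ : WeierstrassCurve ℤ).map (Int.castRingHom ℚ)) =
      ((⟨0, -1, 1, -5, -3⟩ : WeierstrassCurve ℤ).map (Int.castRingHom ℚ)).quadraticTwist (NumberField.discr K : ℚ) := by
    rw [hD]; push_cast; exact minTwist23_smul_eq
  have hrank : 2 ≤ ((⟨0, -1, 1, -5, -3⟩ : WeierstrassCurve ℤ).map (Int.castRingHom ℚ)).mordellWeilRank :=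
    KernelCertsR01.C997b1.two_le_rank
  have hν' : (3277 : ℕ).primeFactors.card ≤ ((⟨0, -1, 1, -5, -3⟩ : WeierstrassCurve ℤ).map (Int.castRingHom ℚ)).mordellWeilRank := by
    refine le_trans (le_of_eq ?_) hrank
    rw [show (3277 : ℕ) = 29 * 113 from rfl, Nat.primeFactors_mul (by norm_num) (by norm_num),
      Nat.Prime.primeFactors (by norm_num), Nat.Prime.primeFactors (by norm_num)]
    decide
  have hμ' : m.primeFactors.card ≤ ((⟨0, -1, 1, -5, -3⟩ : WeierstrassCurve ℤ).map (Int.castRingHom ℚ)).mordellWeilRank := hμ.trans hrank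
  exact cruxBody_of_kuriharaClaims_spade hKim hnf hMaz h84 _ hrank 7 (by norm_num) goodOrdinary_7.1 goodOrdinary_7.2 htower
    (kodairaNeron_of_five_le 7 (by norm_num)) nonAnomalous_7 hsp.1 hS2 K hK hD3 hD4 hpD hH 3277 isCyclicKolyvaginLevel_7_3277 hν' hδE
    ((⟨0, -1, 1, -2821, 55579⟩ : WeierstrassCurve ℤ).map (Int.castRingHom ℚ)) _ hC minTwist23_nonAnomalous_7
    minTwist23_kodairaNeron_7 m hm hμ' hδT

end C997b1

end Summit.BirchSwinnertonDyer.BirchSwinnertonDyer.Theorems.KolyvaginDepthDoor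

end
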